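import Mathlib
import Literature.MathematicalPhysics.QuantumFieldTheory.PointwiseOSReconstruction

/-!
# Sketch (ideator 2, crux `stmt-QuantumFields-16207` = `LangevinControlUV.OSLegsAtWeakCouplingC`)

First-lemma signatures for the crux idea card `axis-cross-analyticity-e1-locality`
(E1 is LOCAL AT THE ORIGIN: reflection positivity along TWO coordinate axes makes the Schwinger
functions jointly real-analytic on the axis-generic chambers — Bernstein–Siciak cross theorem /
Malgrange–Zerner, the engine already landed as `LogSlot.IsSectorData.exists_extension`
(`Literature/…/OSSectorContinuation.lean`) — so rotation invariance on configurations of diameter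
`< r₀` continues analytically to all non-coincident configurations).

Everything here is a `Prop` (statement only, nothing asserted); `lean check` rc 0 is the test.
Vocabulary: the tree's rotation-free POINTWISE OS setting `PointwiseOSReconstruction τ S`
(`CorrFamily 4`, `NonCoincident`, `IsRotationInvariant`).
-/

noncomputable section

open Literature.MathematicalPhysics.QuantumFieldTheory Literature.Probability.LatticeModels
open Set

namespace Summit.QuantumFields.YangMills.Cruxes.OSLegsAtWeakCouplingC.Ideator2

local notation "E4" => EuclideanSpace ℝ (Fin 4)

/-! ## 1. The model-blind complex-analysis lever (two real slots) -/

/-- The open quadrant `(0,∞)²`. -/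
def quadrant : Set (ℝ × ℝ) := Ioi (0 : ℝ) ×ˢ Ioi (0 : ℝ)

/-- **Axis-slot holomorphy** of `W : (0,∞)² → ℝ` in the FIRST variable: for each fixed real
`b > 0` the function `t ↦ W (t, b)` is the restriction of a function holomorphic on the right
half-plane, with bounds locally uniform in `b` away from `Re τ = 0` (in the application:
`W (t, b) = 𝔖₂(t e₀ + b e₁ + ξ⊥) = ⟨Ψ, e^{-tH₀} U₀(b e₁) Ψ⟩`, a matrix element of the `e₀`-frame
transfer semigroup, holomorphic in `Re t > 0` and bounded by `‖Ψ‖²`). -/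
def SlotHolomorphicFst (W : ℝ × ℝ → ℝ) : Prop :=
  ∃ F : ℝ → ℂ → ℂ,
    (∀ b : ℝ, 0 < b → DifferentiableOn ℂ (F b) {τ : ℂ | 0 < τ.re}) ∧
    (∀ b t : ℝ, 0 < b → 0 < t → F b (t : ℂ) = (W (t, b) : ℂ)) ∧
    (∀ δ b₁ b₂ : ℝ, 0 < δ → 0 < b₁ → b₁ ≤ b₂ →
      ∃ M : ℝ, ∀ b : ℝ, b₁ ≤ b → b ≤ b₂ → ∀ τ : ℂ, δ ≤ τ.re → ‖F b τ‖ ≤ M)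

/-- Axis-slot holomorphy in the SECOND variable (the `e₁`-frame reconstruction). -/
def SlotHolomorphicSnd (W : ℝ × ℝ → ℝ) : Prop :=
  SlotHolomorphicFst (fun p => W (p.2, p.1))

/-- **AXIS CROSS-ANALYTICITY** (Bernstein–Siciak cross theorem on the cross
`((0,∞) × {Re > 0}) ∪ ({Re > 0} × (0,∞))`, or Malgrange–Zerner as in the tree's
`OSSectorContinuation`): a function continuous on the open quadrant and slot-holomorphic in each
variable separately (the other variable REAL) is jointly real-analytic on the quadrant.
Size M; classical. [cite: JarnickiPflug2011, Thm. 5.4.1] -/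
def AxisCrossAnalyticity : Prop :=
  ∀ W : ℝ × ℝ → ℝ, ContinuousOn W quadrant → SlotHolomorphicFst W → SlotHolomorphicSnd W →
    AnalyticOnNhd ℝ W quadrant

/-- **PROPAGATION OF ISOTROPY (planar, two-point)**: a real-analytic function on the open
quadrant that is radial on a small quarter-disc is radial on the whole quadrant (polar
coordinates: `∂_φ W` is real-analytic on the connected quadrant and vanishes on an open subset).
Size S; Mathlib (`AnalyticOnNhd.eqOn_of_preconnected_of_eventuallyEq`). [folklore] -/
def IsotropyPropagationPlanar : Prop :=
  ∀ W : ℝ × ℝ → ℝ, AnalyticOnNhd ℝ W quadrant → ∀ r₀ : ℝ, 0 < r₀ →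
    (∀ p ∈ quadrant, ∀ q ∈ quadrant,
        p.1 ^ 2 + p.2 ^ 2 = q.1 ^ 2 + q.2 ^ 2 → p.1 ^ 2 + p.2 ^ 2 < r₀ ^ 2 → W p = W q) →
    ∀ p ∈ quadrant, ∀ q ∈ quadrant, p.1 ^ 2 + p.2 ^ 2 = q.1 ^ 2 + q.2 ^ 2 → W p = W q

/-! ## 2. E1-locality for pointwise OS families with reflection positivity along `e₀` AND `e₁` -/

/-- A linear isometry acting in the `(x₀,x₁)` coordinate plane only (it fixes `e₂` and `e₃`);
together with the coordinate permutations of `W(B₄)` such maps generate `O(4)`. -/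
def IsPlanar01 (R : E4 ≃ₗᵢ[ℝ] E4) : Prop :=
  R (EuclideanSpace.single 2 1) = EuclideanSpace.single 2 1 ∧
    R (EuclideanSpace.single 3 1) = EuclideanSpace.single 3 1

/-- Configurations of diameter `< r₀`. -/
def SmallConfig (n : ℕ) (r₀ : ℝ) (x : Fin n → E4) : Prop :=
  ∀ i j : Fin n, dist (x i) (x j) < r₀

/-- Invariance of the `n`-point function under `R` on the non-coincident configurations
satisfying a side condition `P`. -/
def InvariantOn (S : CorrFamily 4) (n : ℕ) (R : E4 ≃ₗᵢ[ℝ] E4)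
    (P : (Fin n → E4) → Prop) : Prop :=
  ∀ x : Fin n → E4, x ∈ NonCoincident 4 n → P x → S n (fun i => R (x i)) = S n x

/-- **E1-LOCALITY, two-point form (the card's First lemma).** For a pointwise Euclidean family on
`ℝ⁴` admitting the Osterwalder–Schrader reconstruction along the time axis `e₀` AND along `e₁`
(reflection positivity, reflection invariance, E3, translations, polynomial growth — the limit
of Wilson's lattice theory has them along every coordinate axis) whose two-point function is
continuous off the diagonal: if `𝔖₂` is invariant under a planar rotation `R` of the
`(x₀,x₁)`-plane on pairs at distance `< r₀`, it is `R`-invariant at ALL non-coincident pairs.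
Mechanism: the difference variable `ξ ↦ 𝔖₂(0, ξ)` is slot-holomorphic in `ξ₀` (`e₀`-frame
transfer semigroup) and in `ξ₁` (`e₁`-frame), hence jointly real-analytic off the two coordinate
hyperplanes (`AxisCrossAnalyticity`); `ξ ↦ 𝔖₂(0,Rξ) − 𝔖₂(0,ξ)` is real-analytic on each of the
eight open sectors cut out by the lines `ξ₀ξ₁(Rξ)₀(Rξ)₁ = 0`, each sector is a connected cone
meeting the ball of radius `r₀`, so the difference vanishes on a dense open set and, by
continuity, everywhere off the origin. Size M. [folklore] -/
def E1Locality2 : Prop :=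
  ∀ S : CorrFamily 4,
    PointwiseOSReconstruction (τ := (0 : Fin 4)) S → PointwiseOSReconstruction (τ := (1 : Fin 4)) S →
    ContinuousOn (S 2) (NonCoincident 4 2) →
    ∀ R : E4 ≃ₗᵢ[ℝ] E4, IsPlanar01 R → ∀ r₀ : ℝ, 0 < r₀ →
      InvariantOn S 2 R (SmallConfig 2 r₀) → InvariantOn S 2 R (fun _ => True)

/-- **E1-LOCALITY, all orders** (the line-level statement): with reconstructions along `e₀` and
`e₁` and continuity of every `𝔖ₙ` on non-coincident configurations, invariance under a planar
rotation on configurations of diameter `< r₀` implies invariance on ALL non-coincident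
configurations. Mechanism: single-coordinate slot holomorphy of `𝔖ₙ` in each `x_i⁰` (resp.
`x_i¹`) on the chamber where the times (resp. the `x¹`'s) are pairwise distinct — the two-slot
sector continuation between consecutive sharp-time insertions, `OSSectorContinuation` — gives, by
the `2n`-fold cross theorem, joint real-analyticity on the bi-generic chambers; the defect
`𝔖ₙ ∘ R − 𝔖ₙ` is real-analytic on finitely many convex CONES (chambers ∩ `R⁻¹`chambers, in
difference coordinates), each containing configurations of arbitrarily small diameter, hence
vanishes on a dense open set, hence everywhere by continuity. Size L (bookkeeping of chambers).
[folklore] -/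
def E1Locality : Prop :=
  ∀ S : CorrFamily 4,
    PointwiseOSReconstruction (τ := (0 : Fin 4)) S → PointwiseOSReconstruction (τ := (1 : Fin 4)) S →
    (∀ n, ContinuousOn (S n) (NonCoincident 4 n)) →
    ∀ R : E4 ≃ₗᵢ[ℝ] E4, IsPlanar01 R → ∀ r₀ : ℝ, 0 < r₀ →
      (∀ n, InvariantOn S n R (SmallConfig n r₀)) → ∀ n, InvariantOn S n R (fun _ => True)

/-- **The dual form (E1 is also local AT INFINITY)**: invariance on configurations all of whose
pairwise distances exceed `ρ` implies invariance everywhere (same cones, now meeting the exterior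
of every ball). Offered to lines that control glueball asymptotics (mass-gap end) rather than the
femto end. [folklore] -/
def E1LocalityAtInfinity : Prop :=
  ∀ S : CorrFamily 4,
    PointwiseOSReconstruction (τ := (0 : Fin 4)) S → PointwiseOSReconstruction (τ := (1 : Fin 4)) S →
    (∀ n, ContinuousOn (S n) (NonCoincident 4 n)) →
    ∀ R : E4 ≃ₗᵢ[ℝ] E4, IsPlanar01 R → ∀ ρ : ℝ, 0 < ρ →
      (∀ n, InvariantOn S n R (fun x => ∀ i j : Fin n, i ≠ j → ρ < dist (x i) (x j))) →
      ∀ n, InvariantOn S n R (fun _ => True)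

/-- **From one planar rotation family to `O(4)`** (pure group theory, provable now): if every
`𝔖ₙ` is invariant under all isometries acting in the `(x₀,x₁)`-plane and under the coordinate
permutations (hypercubic symmetry of the lattice limit), then `S` is rotation invariant
(`IsRotationInvariant`: all of `O(4)`), since conjugating `O(2)₀₁` by coordinate permutations
gives `O(2)` in every coordinate plane and these generate `O(4)` (Givens). [folklore] -/
def PlanarToO4 : Prop :=
  ∀ S : CorrFamily 4,
    (∀ R : E4 ≃ₗᵢ[ℝ] E4, IsPlanar01 R → ∀ n, InvariantOn S n R (fun _ => True)) →
    (∀ (σ : Equiv.Perm (Fin 4)) (n : ℕ) (x : Fin n → E4),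
        S n (fun i => (LinearIsometryEquiv.piLpCongrLeft 2 ℝ ℝ σ) (x i)) = S n x) →
    IsRotationInvariant S

end Summit.QuantumFields.YangMills.Cruxes.OSLegsAtWeakCouplingC.Ideator2

end
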